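import Summits.BirchSwinnertonDyer.Rank1Residual.X11b.Three.NineDescentCertificate
import Summits.BirchSwinnertonDyer.Rank1Residual.X10.CasselsTatePairingGram
import Summits.BirchSwinnertonDyer.Rank1Residual.Additive.PotGoodOrdinary
import Summits.BirchSwinnertonDyer.Rank1Residual.AdditivePotMult.Descent
import HarnessLib

/-!
# (S12) Rank-ONE rows closed PER PAIR by TWO FINITE CERTIFICATES — no typed leading-term object
# (cell `b2b-bsdres`, team n1011, seat p16 GEN 5; row T-S12-K = the KERNEL side of route planner 3's
# sub-target (S12), `cells/n1011/ROUTE-3.md` l.108; sequel of (S11), `RankOneUpperHalfDescentCount`)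

HONEST FRAMING (cell `b2b-bsdres`, run/shared/lean/b2b/bsd-rank1-residual/, verbatim in every
file): the goal of the cell is to DELETE the COMBINATION-SHAPED residual classes of the
Birch–Swinnerton-Dyer formula for ALL analytic-rank `≤ 1` elliptic curves over `ℚ` — "full BSD
formula for every rank `≤ 1` curve in class `C`" assembled STRICTLY from published theorems — so
that the rank-`≤ 1` remainder becomes exactly the CONSTRUCTION-SHAPED classes, which are TYPED
(missing-input `Prop`s), NOT attempted. This is not "finishing BSD". Team n1011 (N10 / N11 / O7),
seat p16: research route; X4 stays CONSTRUCTION-SHAPED; these are PER-PAIR record shapes, not class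
theorems; they close NO class and move NO mark; the certificate literals are x-lane / instrument
outputs (EVIDENCE when instantiated; none is instantiated here); nothing is booked; no Literature
fact is minted. Theorems only (no `def`, no `sorry`, no new named fact).

## What

(S10) / (S11) keep route 3's typed UPPER object (a (B)-datum `hB`, the Schneider rider `hS`, the
row's branch `p`-adic Gross–Zagier `hGZ`, Kato's half) and take at most the LOWER half from a
certificate. (S12) replaces the UPPER half too by a SECOND FINITE CERTIFICATE: on a rank-one pair with
`ord_p #Ш_an(E) = 2` and `E[p]` irreducible (so `#E(ℚ)[p] = 1`, Mazur), the COMPLETE first descent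
`#Sel^(p)(E/ℚ) = p^(1+2)` gives `#Ш(E)[p] = p²` exactly, and "`Ш(E)[p²] = Ш(E)[p]`" — certified
EITHER by the second-descent COUNT `#Sel^(p²)(E/ℚ) = p^(2+2)` (Creutz; consumer = x11b3-p5's
class-free `X11b.Three.bsdp_three_of_irr_of_card_selmerThree_of_card_selmerNine`, consumed BY NAME)
OR by a Cassels–Tate GRAM certificate `[0 g; g′ 0]`, `g, g′ ≠ 0`, on two `p`-torsion classes of `Ш`
(Fisher–Newton; x10's algebra `X10.sq_nsmul_stable_of_gram` BY NAME) — then gives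
`Ш(E)[p^∞] ≅ (ℤ/p)²` and Miller's `BSD(E,p)` (`Typed.bsdp_of_card_selmer_stable`). Inputs beyond the
pair: Gross–Zagier–Kolyvagin (`hGZK`) ONLY.

* `bsdp_of_ctpGram_of_card_selmerGroup_of_analyticRank_le_one` — CLASS-FREE, every prime, analytic
  rank `≤ 1`: the rank-`≤ 1` twin of x10's `X10.bsdp_of_ctpGram_of_card_selmerGroup` (which is
  `r_an = 0` only); `bsdp_of_ctpNondegenerate_of_card_selmerGroup_of_analyticRank_le_one` — the same
  from a non-degeneracy certificate of any dimension (`#Sel^(p) = p^(r_an + m)`, `ord_p #Ш_an = m`);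
* X4 wrappers at `p = 3`, rank one (`#E(ℚ)[3] = 1` from the class's `Irr`): Gram road
  `ClassX4Gord/ClassX4M.bsdp_three_rankOne_of_ctpGram_of_card_selmerThree`, count road
  `ClassX4Gord/ClassX4M.bsdp_three_rankOne_of_card_selmerThree_of_card_selmerNine` (0 new
  mathematics on the count road: x11b3's E-K10(a) theorem with `Irr` from the X4 class).

Route planner 3's sizing (ROUTE-3 l.102 (e) / l.108, zero compute, EVIDENCE): the target rows are the
40 SHA3 classes of the O7-ord ∩ X4@3 rank-one residue (`N < 5·10⁵`; Gord3 12, M 28; every one surj(3),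
`ord₃ #Ш_an = 2`). Certificate 1 (`#Sel^(3) = 27`, an EQUALITY ⇒ EXACT mode) is in hand for 2/40
(90459m1, 117648y1; x11c GEN 15); certificate 2 (B-1 second 3-descent or a ctp-sel3 Gram document)
for 0/40 today. r3's first refutable prediction P-S12: certificate 2 comes out STABLE on all 40
(a singular Gram / NONEMPTY verdict would read `27 ∣ #Ш(E)` — against BSD₃ at certificate grade).
References: [SilvermanAEC2009] Thm. X.4.2 (a); [Mazur1977] III §5; [Cassels1998] §1;
[FisherNewton2014] Thm. 1.3; [Creutz2014] §1; [Miller2011LMS] §1, Def. 1.1.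
-/

noncomputable section

open scoped Classical

open WeierstrassCurve Literature.NumberTheory.EllipticCurves
  Literature.NumberTheory.EllipticCurves.Rank1Residual
  Literature.NumberTheory.EllipticCurves.Rank1Residual.Typed

namespace Summit.BirchSwinnertonDyer.Rank1Residual.Additive

/-! ## §1 Class-free, every prime, analytic rank `≤ 1` -/

section ClassFree

variable (W : WeierstrassCurve ℚ) [W.IsElliptic] (p : ℕ) [hp : Fact p.Prime]

/-- **`BSD(E,p)` in analytic rank `≤ 1` from ONE complete `p`-descent + a Cassels–Tate GRAM
certificate** (class-free, every prime; the rank-`≤ 1` twin of x10's rank-`0`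
`X10.bsdp_of_ctpGram_of_card_selmerGroup`): GZK (`hGZK`: `rank = r_an`, `Ш` finite), `#E(ℚ)[p] = 1`,
the complete count `#Sel^(p)(E/ℚ) = p^(r_an + 2)` (so `#Ш(E)[p] = p²`,
`Typed.card_torsionBy_sha_eq_of_card_selmerGroup`), a bi-additive pairing `B` on `Ш(E/ℚ)` with Gram
shape `[0 g; g′ 0]`, `g, g′ ≠ 0`, on two `p`-torsion classes (so `Ш[p²] = Ш[p]`,
`X10.sq_nsmul_stable_of_gram`), and `ord_p #Ш_an = 2` ⇒ Miller's `BSD(E,p)`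
(`Typed.bsdp_of_card_selmer_stable`). Intended `B`: the Cassels–Tate pairing, its Gram matrix printed
per pair by a ctp-sel3 document (x10 route A). Per pair; not a class theorem; nothing booked.
[cite: FisherNewton2014, Thm. 1.3 and eqs. (1)–(2)] [cite: Cassels1998, §1]
[cite: SilvermanAEC2009, Thm. X.4.2(a)] [cite: Miller2011LMS, §1 and Def. 1.1] -/
theorem bsdp_of_ctpGram_of_card_selmerGroup_of_analyticRank_le_one
    (hGZK : rank_eq_analyticRank_of_analyticRank_le_one) (hr : W.analyticRank ≤ 1)
    (htors : Nat.card (AddSubgroup.torsionBy W.toAffine.Point (p : ℤ)) = 1)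
    (hcard : Nat.card (W.selmerGroup (p : ℤ)) = p ^ (W.analyticRank + 2))
    {Q : Type*} [AddCommGroup Q] (B : W.sha →+ W.sha →+ Q) {x₁ x₂ : W.sha}
    (hx₁ : p • x₁ = 0) (hx₂ : p • x₂ = 0)
    (h₁₁ : B x₁ x₁ = 0) (h₂₂ : B x₂ x₂ = 0) (h₁₂ : B x₁ x₂ ≠ 0) (h₂₁ : B x₂ x₁ ≠ 0)
    {q : ℚ} (hq : shaAn W = (q : ℂ)) (hv : padicValRat p q = 2) : BSDp W p := by
  have hrank : W.mordellWeilRank = W.analyticRank := (hGZK W hr).1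
  -- the binder's computable `DecidableEq ℚ` vs the classical one of the number-field theorems
  -- (transport along `Subsingleton.elim`, as in `X11b/Three/NineDescentCertificate.lean`)
  have hinst : (instDecidableEqRat : DecidableEq ℚ) = fun a b => Classical.propDecidable (a = b) :=
    Subsingleton.elim _ _
  have htors' := htors
  rw [hinst] at htors'
  haveI : NeZero p := ⟨hp.out.ne_zero⟩
  -- `#Ш(E/ℚ)[p] = p²` from the complete `p`-descent
  have hsha : Nat.card (AddSubgroup.torsionBy W.sha (p : ℕ)) = p ^ 2 :=
    card_torsionBy_sha_eq_of_card_selmerGroup W p (a := p ^ W.analyticRank) (c := p ^ 2)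
      (by rw [hrank, htors', mul_one]) (pow_pos hp.out.pos _) (by rw [hcard, pow_add])
  -- the Gram certificate ⇒ `Ш[p²] = Ш[p]`
  have hstab : ∀ x : W.sha, p ^ 2 • x = 0 → p • x = 0 :=
    X10.sq_nsmul_stable_of_gram B hx₁ hx₂ h₁₁ h₂₂ h₁₂ h₂₁ hsha
  -- one complete `p`-descent + stabilisation ⇒ `BSD(E,p)`
  refine bsdp_of_card_selmer_stable W p hGZK hr (k := 1) (m := 2) (b := 1) ?_ Nat.one_pos ?_ ?_ hq
    (by exact_mod_cast hv)
  · rw [pow_one]; exact htors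
  · rw [pow_one, hcard, pow_add, mul_one]
  · intro x hx
    rw [pow_one]
    exact hstab x hx

/-- **The same from a NON-DEGENERACY certificate of any dimension** (the rank-`≤ 1` twin of x10's
`X10.bsdp_of_ctpNondegenerate_of_card_selmerGroup`): GZK, `#E(ℚ)[p] = 1`,
`#Sel^(p)(E/ℚ) = p^(r_an + m)`, a bi-additive pairing on `Ш(E/ℚ)` non-degenerate on `Ш[p]`
(`X10.sq_nsmul_stable_of_nondegenerate`), `ord_p #Ш_an = m` ⇒ `BSD(E,p)`. Per pair.
[cite: Cassels1998, §1] [cite: SilvermanAEC2009, Thm. X.4.2(a)] [cite: Miller2011LMS, §1 and Def. 1.1] -/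
theorem bsdp_of_ctpNondegenerate_of_card_selmerGroup_of_analyticRank_le_one
    (hGZK : rank_eq_analyticRank_of_analyticRank_le_one) (hr : W.analyticRank ≤ 1)
    (htors : Nat.card (AddSubgroup.torsionBy W.toAffine.Point (p : ℤ)) = 1) {m : ℕ}
    (hcard : Nat.card (W.selmerGroup (p : ℤ)) = p ^ (W.analyticRank + m))
    {Q : Type*} [AddCommGroup Q] (B : W.sha →+ W.sha →+ Q)
    (hnd : ∀ ξ : W.sha, p • ξ = 0 → ξ ≠ 0 → ∃ y : W.sha, p • y = 0 ∧ B ξ y ≠ 0)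
    {q : ℚ} (hq : shaAn W = (q : ℂ)) (hv : padicValRat p q = m) : BSDp W p := by
  have hstab : ∀ x : W.sha, p ^ 2 • x = 0 → p • x = 0 :=
    X10.sq_nsmul_stable_of_nondegenerate B hnd
  refine bsdp_of_card_selmer_stable W p hGZK hr (k := 1) (m := m) (b := 1) ?_ Nat.one_pos ?_ ?_ hq hv
  · rw [pow_one]; exact htors
  · rw [pow_one, hcard, pow_add, mul_one]
  · intro x hx
    rw [pow_one]
    exact hstab x hx

end ClassFree

/-! ## §2 The X4♯(G-ord) wrappers at `p = 3`, rank one -/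

section Gord

variable {W : WeierstrassCurve ℚ} [W.IsElliptic]

/-- **(S12-ct) X4♯(G-ord)@3, `r_an = 1`: `#Sel^(3)(E/ℚ) = 27` (complete first descent, EXACT) + a
Cassels–Tate Gram certificate `[0 g; g′ 0]` on two `3`-torsion classes of `Ш` + `ord₃ #Ш_an = 2` ⇒
`BSD(E,3)`** — `#E(ℚ)[3] = 1` by irreducibility (Mazur;
`natCard_torsionBy_eq_one_of_hasIrreducibleModPGaloisRep`). NO typed leading-term object, NO Kato half,
NO tower; inputs beyond the pair: GZK. Per pair (target: the 40 SHA3 rank-one X4@3 rows); closes no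
class. [cite: FisherNewton2014, Thm. 1.3] [cite: Mazur1977, Ch. III §5, p. 157]
[cite: SilvermanAEC2009, Thm. X.4.2(a)] [cite: Miller2011LMS, §1 and Def. 1.1] -/
theorem ClassX4Gord.bsdp_three_rankOne_of_ctpGram_of_card_selmerThree
    (hGZK : rank_eq_analyticRank_of_analyticRank_le_one) (hX : ClassX4Gord W 3)
    (hr : W.analyticRank = 1) (hcard : Nat.card (W.selmerGroup (3 : ℤ)) = 3 ^ 3)
    {Q : Type*} [AddCommGroup Q] (B : W.sha →+ W.sha →+ Q) {x₁ x₂ : W.sha}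
    (hx₁ : 3 • x₁ = 0) (hx₂ : 3 • x₂ = 0)
    (h₁₁ : B x₁ x₁ = 0) (h₂₂ : B x₂ x₂ = 0) (h₁₂ : B x₁ x₂ ≠ 0) (h₂₁ : B x₂ x₁ ≠ 0)
    {q : ℚ} (hq : shaAn W = (q : ℂ)) (hv : padicValRat 3 q = 2) : BSDp W 3 :=
  haveI : Fact (Nat.Prime 3) := ⟨Nat.prime_three⟩
  bsdp_of_ctpGram_of_card_selmerGroup_of_analyticRank_le_one W 3 hGZK hr.le
    (natCard_torsionBy_eq_one_of_hasIrreducibleModPGaloisRep W 3 hX.1.2.2)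
    (by rw [hr]; exact_mod_cast hcard) B hx₁ hx₂ h₁₁ h₂₂ h₁₂ h₂₁ hq hv

/-- **(S12-9) X4♯(G-ord)@3, `r_an = 1`, COUNT currency: `#Sel^(3)(E/ℚ) = 27`,
`#Sel^(9)(E/ℚ) = 81`, `ord₃ #Ш_an = 2` ⇒ `BSD(E,3)`** — x11b3-p5's class-free
`X11b.Three.bsdp_three_of_irr_of_card_selmerThree_of_card_selmerNine` with `Irr` from the class
(0 new mathematics; the E-K10(a) road transplanted from X11@3 to X4@3). Per pair; closes no class.
[cite: Creutz2014, §1] [cite: SilvermanAEC2009, Thm. X.4.2(a)] [cite: Mazur1977, Ch. III §5, p. 157]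
[cite: Miller2011LMS, §1 and Def. 1.1] -/
theorem ClassX4Gord.bsdp_three_rankOne_of_card_selmerThree_of_card_selmerNine
    (hGZK : rank_eq_analyticRank_of_analyticRank_le_one) (hX : ClassX4Gord W 3)
    (hr : W.analyticRank = 1) (h3 : Nat.card (W.selmerGroup (3 : ℤ)) = 3 ^ 3)
    (h9 : Nat.card (W.selmerGroup (9 : ℤ)) = 3 ^ 4)
    {s : ℚ} (hs : shaAn W = (s : ℂ)) (hv : padicValRat 3 s = 2) : BSDp W 3 :=
  X11b.Three.bsdp_three_of_irr_of_card_selmerThree_of_card_selmerNine W hGZK hr hX.1.2.2 (k := 2)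
    h3 h9 hs (by exact_mod_cast hv)

end Gord

end Summit.BirchSwinnertonDyer.Rank1Residual.Additive

/-! ## §3 The X4(M) wrappers at `p = 3`, rank one -/

namespace Summit.BirchSwinnertonDyer.Rank1Residual.AdditivePotMult

open Additive

variable {W : WeierstrassCurve ℚ} [W.IsElliptic]

/-- **(S12-ct) X4(M)@3 ∧ surj(3) class, `r_an = 1`: `#Sel^(3)(E/ℚ) = 27` + a Cassels–Tate Gram
certificate + `ord₃ #Ш_an = 2` ⇒ `BSD(E,3)`** (`#E(ℚ)[3] = 1` from `ClassX4M.irr`). Per pair; closes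
no class. [cite: FisherNewton2014, Thm. 1.3] [cite: Mazur1977, Ch. III §5, p. 157]
[cite: SilvermanAEC2009, Thm. X.4.2(a)] [cite: Miller2011LMS, §1 and Def. 1.1] -/
theorem ClassX4M.bsdp_three_rankOne_of_ctpGram_of_card_selmerThree
    (hGZK : rank_eq_analyticRank_of_analyticRank_le_one) (hX : ClassX4M W 3)
    (hr : W.analyticRank = 1) (hcard : Nat.card (W.selmerGroup (3 : ℤ)) = 3 ^ 3)
    {Q : Type*} [AddCommGroup Q] (B : W.sha →+ W.sha →+ Q) {x₁ x₂ : W.sha}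
    (hx₁ : 3 • x₁ = 0) (hx₂ : 3 • x₂ = 0)
    (h₁₁ : B x₁ x₁ = 0) (h₂₂ : B x₂ x₂ = 0) (h₁₂ : B x₁ x₂ ≠ 0) (h₂₁ : B x₂ x₁ ≠ 0)
    {q : ℚ} (hq : shaAn W = (q : ℂ)) (hv : padicValRat 3 q = 2) : BSDp W 3 :=
  haveI : Fact (Nat.Prime 3) := ⟨Nat.prime_three⟩
  bsdp_of_ctpGram_of_card_selmerGroup_of_analyticRank_le_one W 3 hGZK hr.le
    (natCard_torsionBy_eq_one_of_hasIrreducibleModPGaloisRep W 3 (ClassX4M.irr W 3 hX))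
    (by rw [hr]; exact_mod_cast hcard) B hx₁ hx₂ h₁₁ h₂₂ h₁₂ h₂₁ hq hv

/-- **(S12-9) X4(M)@3 ∧ surj(3) class, `r_an = 1`, COUNT currency: `#Sel^(3) = 27`, `#Sel^(9) = 81`,
`ord₃ #Ш_an = 2` ⇒ `BSD(E,3)`** — x11b3-p5's two-count theorem with `Irr` from `ClassX4M.irr`.
Per pair; closes no class. [cite: Creutz2014, §1] [cite: SilvermanAEC2009, Thm. X.4.2(a)]
[cite: Mazur1977, Ch. III §5, p. 157] [cite: Miller2011LMS, §1 and Def. 1.1] -/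
theorem ClassX4M.bsdp_three_rankOne_of_card_selmerThree_of_card_selmerNine
    (hGZK : rank_eq_analyticRank_of_analyticRank_le_one) (hX : ClassX4M W 3)
    (hr : W.analyticRank = 1) (h3 : Nat.card (W.selmerGroup (3 : ℤ)) = 3 ^ 3)
    (h9 : Nat.card (W.selmerGroup (9 : ℤ)) = 3 ^ 4)
    {s : ℚ} (hs : shaAn W = (s : ℂ)) (hv : padicValRat 3 s = 2) : BSDp W 3 :=
  X11b.Three.bsdp_three_of_irr_of_card_selmerThree_of_card_selmerNine W hGZK hr (ClassX4M.irr W 3 hX)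
    (k := 2) h3 h9 hs (by exact_mod_cast hv)

end Summit.BirchSwinnertonDyer.Rank1Residual.AdditivePotMult

end
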